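import Literature.NumberTheory.GelbartRogawski1991.LocalDoubledSiegelDetTwist
import Literature.NumberTheory.GelbartRogawski1991.LocalSplittingCMParabolicEigenfunctional
import Literature.NumberTheory.GelbartRogawski1991.LocalDoubledKroneckerEmbedding
import HarnessLib

/-!
# The TWISTED SECTION of the soft road and its EIGEN-LAW: `λ′(s′(p) Φ) = Δ_{P_Δ}(p) · λ′(Φ)` on the Siegel parabolic of `U(W ⊕ −W)(L⁺_v)`

[Kudla1994] S. S. Kudla, Israel J. Math. 87 (1994), §3 Thm. 3.1; [HarrisKudlaSweet1996] §1 (1.15)–(1.16) (the character `χ(x(p)) |x(p)|^{s}` of the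
Siegel parabolic in the local Weil representation); [KudlaRallis1994] ∕ [GelbartRogawski1991] §3 (doubling: `ω_{V, W ⊕ −W} → I(s₀)`, `s₀ = (dim V − dim W)∕2`);
[MoeglinVignerasWaldspurger1987] Chap. 2 II.8 (smoothness).  Topic `NumberTheory/GelbartRogawski1991`; namespace
`Literature.NumberTheory.GelbartRogawski1991.UnitaryDualPair.LocalSplitting`.  THEOREMS ONLY (no definition, no instance, no notation, no named fact,
no `sorry`).

THE SETTING (cell hodgecm-mathlib, line LD2, soft road (π3) for the organ `LineThetaTypesComplementary₁`; RULING (β) of LD2-plan (g2) and DEALS #12 (4) of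
LD2-plan (g3)).  `L ⊃ L⁺` CM, `v` finite, `χ` a Hecke character of `L` with `IsSplittingChar L 1 χ`, `μ_v = localMu L χ v`.  `G₁ = U(W ⊕ −W)(L⁺_v)` is the
doubled rank-ONE group `localPi L c̄ (1+1) J^𝔻₁ v` of a line `T₀` with Siegel parabolic `P` (★ `IsSiegelDelta`); `H₂ = U(V ⊕ −V)(L⁺_v)` the doubled
rank-TWO group of a plane `T_V` carrying Kudla's CM datum `s^𝔻 = (localSplittingDatumCM L v μ 2 …).localSplitting` and `ω^𝔻 = toRep ∘ s^𝔻` on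
`𝒮(L⁺_v^{2+2})`; `λ′ Φ = (ω^𝔻(m₀) Φ)(0)` for an implementer `m₀` carrying `ℓ_Δ` onto `ℓ_Y` (★ `apply_zero_toRep_mul_localSplitting_eq_mul` with `w₀ := 1`);
and the KRONECKER embedding enters ABSTRACTLY as a continuous homomorphism `ι : G₁ →* H₂` with (i) `IsSiegelDelta¹ p → IsSiegelDelta² (ι p)` and
(ii) `det_Δ² (ι p)_w = (det_Δ¹ p_w)²` (★-to-be `kronLoc`, `IsSiegelDelta.kronLoc`, `detDelta_kronLoc`, seat LD2-p02 (g3)).  THE TWISTED SECTION is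
`s′ h := μ_v(det h)⁻¹ • ω^𝔻(s^𝔻(ι h))` (`det h` = Mathlib `GeneralLinearGroup.det` of the matrix of `h` over `E_v`, ★ `localPiEquiv`), written INLINE
(no definition).

* §1 **`twistedSection_mul`**: `s′(g h) = s′(g) ∘ s′(h)` for ALL `g, h ∈ G₁` (all factors are homomorphisms).
* §2 **`apply_zero_toRep_twistedSection_eq_modularCharacter_mul`** — THE EIGEN-LAW: for `p ∈ P`,
  `λ′(s′(p) Φ) = Δ_P(p) · λ′(Φ)` with `Δ_P` = Mathlib's `modularCharacter` of `↥P` (convention `map (· g) μ = Δ(g) • μ`): the ★ eigen-law at `n = 2`,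
  `w₀ = 1`, `p′ = ι p` gives the scalar `χ_v(det_Δ²(ι p)) · ∏_w ‖det_Δ²(ι p)_w‖^{1∕2}`, and ★ `twistScalar_eq_modularCharacter` (FILE A) shows that times
  `μ_v(det p)⁻¹` it IS `Δ_P(p)` (`χ_v(a²) = μ_v(det p)`, `∏_w ‖a_w²‖^{1∕2} = ‖a‖ = Δ_P(p)`, `a = det_Δ¹ p`).
* §3 **`isLocallyConstant_toRep_localSplitting_comp`**, **`continuous_apply_twistedSection`**: `h ↦ ω^𝔻(s^𝔻(ι h)) Φ` is locally constant on `G₁` (the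
  datum's smoothness field ★ `LocalSplittingDatum.smooth`, `ι` continuous), so for EVERY linear functional `Λ` the orbit function `h ↦ Λ(s′(h) Φ)` is continuous
  (`μ_v`, `det`, `localPiEquiv` continuous).
These are exactly the inputs «`σ (p h) = σ p ∘ σ h`, eigen-law `lam (σ p Φ) = Δ_P(p) lam Φ`, continuity of `h ↦ lam (σ h Φ)`» of the (π3) density glue (★-to-be
`LocalDoubledInvariantFunctionalOfFixedVector`, seat A-p19 (g31)) at `σ := s′`, `lam := λ′`.

`--supports stmt-HodgeConjecture-24832`; HONEST LABEL: HC_CM is proved only modulo the 7 printed citations (2 remaining: hLiu418 = stmt-HodgeConjecture-24832,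
h413 = stmt-HodgeConjecture-24833) until rung 0 closes; this file discharges no named fact (count-neutral).

## References
* [Kudla1994] S. S. Kudla, *Splitting metaplectic covers of dual reductive pairs*, Israel J. Math. 87 (1994) 361–401, §3 Thm. 3.1.
* [HarrisKudlaSweet1996] M. Harris, S. S. Kudla, W. J. Sweet, J. Amer. Math. Soc. 9 (1996) 941–1004, §1 (1.15)–(1.16).
* [GelbartRogawski1991] S. Gelbart, J. Rogawski, Invent. Math. 105 (1991), §3.1 Prop. 3.1.1, §3.2.
* [MoeglinVignerasWaldspurger1987] C. Mœglin, M.-F. Vignéras, J.-L. Waldspurger, LNM 1291 (1987), Chap. 2 II.1, II.8.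
-/

set_option autoImplicit false

noncomputable section

open NumberField IsDedekindDomain MeasureTheory MeasureTheory.Measure Matrix Filter
open scoped NNReal MatrixGroups Topology
open Literature.RepresentationTheory.HeisenbergGroup
open Literature.NumberTheory.Automorphic Literature.NumberTheory.Automorphic.UnitaryGroup Literature.NumberTheory.Weil1964
open Literature.NumberTheory.GaloisRepresentations Literature.RepresentationTheory.HarrisKudlaSweet1996

namespace Literature.NumberTheory.GelbartRogawski1991.UnitaryDualPair.LocalSplitting

variable (L : Type) [Field L] [NumberField L] [IsCMField L] (v : HeightOneSpectrum (𝓞 ↥(maximalRealSubfield L)))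
  [MeasurableSpace (v.adicCompletion ↥(maximalRealSubfield L))] [BorelSpace (v.adicCompletion ↥(maximalRealSubfield L))]
  (μ : Measure (v.adicCompletion ↥(maximalRealSubfield L))) [μ.IsAddHaarMeasure]
  (χ : HeckeCharacter L) (hχ : IsSplittingChar L 1 χ)
  {TV : Matrix (Fin 2) (Fin 2) ↥(maximalRealSubfield L)} (hTV : TV.IsSymm) (hTVd : IsUnit TV.det)
  {JD₁ : Matrix (Fin (1 + 1)) (Fin (1 + 1)) L}
  (ι : UnitaryGroup.localPi L (IsCMField.complexConj L) (1 + 1) JD₁ v →*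
    UnitaryGroup.localPi L (IsCMField.complexConj L) (2 + 2)
      ((gramD (↥(maximalRealSubfield L)) 2 TV).map (algebraMap (↥(maximalRealSubfield L)) L)) v)

/-! ## §1 The twisted section is multiplicative -/

set_option synthInstance.maxHeartbeats 400000 in -- the doubled CM datum's telescope
set_option maxHeartbeats 4000000 in
/-- **`s′(g h) = s′(g) ∘ s′(h)` on all of `G₁`** for the twisted section `s′ h := μ_v(det h)⁻¹ • ω^𝔻(s^𝔻(ι h))` (`ι`, `s^𝔻`, `ω^𝔻 = toRep`, `det`,
`localPiEquiv`, `μ_v` are homomorphisms; `(a • A)(b • B) = (ab) • (AB)` in `End_ℂ 𝒮`). [cite: Kudla1994, §3 Thm. 3.1] [cite: MoeglinVignerasWaldspurger1987, Chap. 2 II.1] -/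
theorem twistedSection_mul (g h : UnitaryGroup.localPi L (IsCMField.complexConj L) (1 + 1) JD₁ v) :
    (((localMu L χ v (Matrix.GeneralLinearGroup.det ((localPiEquiv L (IsCMField.complexConj L) (1 + 1) JD₁ v (g * h)).1)))⁻¹ : ℂˣ) : ℂ) •
        MpPsi.toRep (localSchrodinger (↥(maximalRealSubfield L)) (2 + 2) (gramD (↥(maximalRealSubfield L)) 2 TV) v)
          ((localSplittingDatumCM L v μ 2 hTV hTVd rfl χ hχ).localSplitting (ι (g * h))) =
      ((((localMu L χ v (Matrix.GeneralLinearGroup.det ((localPiEquiv L (IsCMField.complexConj L) (1 + 1) JD₁ v g).1)))⁻¹ : ℂˣ) : ℂ) •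
          MpPsi.toRep (localSchrodinger (↥(maximalRealSubfield L)) (2 + 2) (gramD (↥(maximalRealSubfield L)) 2 TV) v)
            ((localSplittingDatumCM L v μ 2 hTV hTVd rfl χ hχ).localSplitting (ι g))) *
        ((((localMu L χ v (Matrix.GeneralLinearGroup.det ((localPiEquiv L (IsCMField.complexConj L) (1 + 1) JD₁ v h).1)))⁻¹ : ℂˣ) : ℂ) •
          MpPsi.toRep (localSchrodinger (↥(maximalRealSubfield L)) (2 + 2) (gramD (↥(maximalRealSubfield L)) 2 TV) v)
            ((localSplittingDatumCM L v μ 2 hTV hTVd rfl χ hχ).localSplitting (ι h))) := by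
  have hdet : Matrix.GeneralLinearGroup.det ((localPiEquiv L (IsCMField.complexConj L) (1 + 1) JD₁ v (g * h)).1) =
      Matrix.GeneralLinearGroup.det ((localPiEquiv L (IsCMField.complexConj L) (1 + 1) JD₁ v g).1) *
        Matrix.GeneralLinearGroup.det ((localPiEquiv L (IsCMField.complexConj L) (1 + 1) JD₁ v h).1) := by
    rw [map_mul (localPiEquiv L (IsCMField.complexConj L) (1 + 1) JD₁ v) g h, Subgroup.coe_mul,
      map_mul Matrix.GeneralLinearGroup.det]
  have hι : ι (g * h) = ι g * ι h := map_mul ι g h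
  have hs : (localSplittingDatumCM L v μ 2 hTV hTVd rfl χ hχ).localSplitting (ι g * ι h) =
      (localSplittingDatumCM L v μ 2 hTV hTVd rfl χ hχ).localSplitting (ι g) *
        (localSplittingDatumCM L v μ 2 hTV hTVd rfl χ hχ).localSplitting (ι h) := map_mul _ _ _
  have hω : MpPsi.toRep (localSchrodinger (↥(maximalRealSubfield L)) (2 + 2) (gramD (↥(maximalRealSubfield L)) 2 TV) v)
        ((localSplittingDatumCM L v μ 2 hTV hTVd rfl χ hχ).localSplitting (ι g) *
          (localSplittingDatumCM L v μ 2 hTV hTVd rfl χ hχ).localSplitting (ι h)) =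
      MpPsi.toRep (localSchrodinger (↥(maximalRealSubfield L)) (2 + 2) (gramD (↥(maximalRealSubfield L)) 2 TV) v)
          ((localSplittingDatumCM L v μ 2 hTV hTVd rfl χ hχ).localSplitting (ι g)) *
        MpPsi.toRep (localSchrodinger (↥(maximalRealSubfield L)) (2 + 2) (gramD (↥(maximalRealSubfield L)) 2 TV) v)
          ((localSplittingDatumCM L v μ 2 hTV hTVd rfl χ hχ).localSplitting (ι h)) := map_mul _ _ _
  rw [smul_mul_smul_comm]
  congr 1
  · rw [hdet, map_mul (localMu L χ v), mul_inv, Units.val_mul]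
  · exact (congrArg (fun x => MpPsi.toRep (localSchrodinger (↥(maximalRealSubfield L)) (2 + 2) (gramD (↥(maximalRealSubfield L)) 2 TV) v)
        ((localSplittingDatumCM L v μ 2 hTV hTVd rfl χ hχ).localSplitting x)) hι).trans
      ((congrArg (MpPsi.toRep (localSchrodinger (↥(maximalRealSubfield L)) (2 + 2) (gramD (↥(maximalRealSubfield L)) 2 TV) v)) hs).trans hω)

/-! ## §2 THE EIGEN-LAW of the twisted section on the Siegel parabolic -/

set_option synthInstance.maxHeartbeats 400000 in -- the doubled CM datum's telescope
set_option maxHeartbeats 4000000 in -- (as in ★ `LocalSplittingCMParabolicEigenfunctional`)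
/-- **THE EIGEN-LAW `λ′(s′(p) Φ) = Δ_{P_Δ}(p) · λ′(Φ)`.**  For `p` in the Siegel parabolic `P` of the doubled rank-one group `G₁ = U(W ⊕ −W)(L⁺_v)` (line `T₀`),
the twisted section `s′ p = μ_v(det p)⁻¹ • ω^𝔻(s^𝔻(ι p))` through a Kronecker-type homomorphism `ι : G₁ →* H₂` (`IsSiegelDelta¹ p → IsSiegelDelta² (ι p)`,
`det_Δ²(ι p)_w = (det_Δ¹ p_w)²`) acts on the parabolic `Δ`-functional `λ′ = ev₀ ∘ ω^𝔻(m₀)` by MATHLIB's modular character of `↥P` (`map (· g) μ = Δ(g) • μ`;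
`Δ_{P_Δ}(m_a n_b) = |a ā|_{L⁺_v}`): ★ `apply_zero_toRep_mul_localSplitting_eq_mul` at `n = 2`, `w₀ = 1`, `p′ = ι p`, then ★ `twistScalar_eq_modularCharacter`.
So `h ↦ λ′(s′(h) Φ)` lies in `Ind_P^{G₁}(Δ_P)` = the doubling's `I(s₀)`, `s₀ = (2 − 1)∕2 = ρ`, the point where `𝟙` is a quotient.
[cite: Kudla1994, §3 Thm. 3.1] [cite: HarrisKudlaSweet1996, §1 (1.15)–(1.16)] [cite: GelbartRogawski1991, §3.2] -/
theorem apply_zero_toRep_twistedSection_eq_modularCharacter_mul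
    {T₀ : Matrix (Fin 1) (Fin 1) ↥(maximalRealSubfield L)} (hT₀ : T₀.IsSymm) (hT₀d : IsUnit T₀.det)
    (hJD₁ : JD₁ = (gramD (↥(maximalRealSubfield L)) 1 T₀).map (algebraMap (↥(maximalRealSubfield L)) L))
    (P : Subgroup (UnitaryGroup.localPi L (IsCMField.complexConj L) (1 + 1) JD₁ v))
    (hP : ∀ h, h ∈ P ↔ IsSiegelDelta (↥(maximalRealSubfield L)) L (IsCMField.complexConj L) (complexConj_imagUnit L)
      (imagUnit_ne_zero L) (imagUnit_mul_self L) v 1 hT₀ hJD₁ h)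
    [LocallyCompactSpace ↥P]
    (hιS : ∀ p : UnitaryGroup.localPi L (IsCMField.complexConj L) (1 + 1) JD₁ v,
      IsSiegelDelta (↥(maximalRealSubfield L)) L (IsCMField.complexConj L) (complexConj_imagUnit L) (imagUnit_ne_zero L) (imagUnit_mul_self L)
          v 1 hT₀ hJD₁ p →
        IsSiegelDelta (↥(maximalRealSubfield L)) L (IsCMField.complexConj L) (complexConj_imagUnit L) (imagUnit_ne_zero L) (imagUnit_mul_self L)
          v 2 hTV rfl (ι p))
    (hιd : ∀ (p : UnitaryGroup.localPi L (IsCMField.complexConj L) (1 + 1) JD₁ v) (w : PlacesOver L v),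
      detDelta (↥(maximalRealSubfield L)) L (IsCMField.complexConj L) v 2 w (ι p) =
        detDelta (↥(maximalRealSubfield L)) L (IsCMField.complexConj L) v 1 w p ^ 2)
    (m₀ : LocalMp (↥(maximalRealSubfield L)) (2 + 2) (gramD (↥(maximalRealSubfield L)) 2 TV) v)
    (hm₀ : (deltaLagrangian (↥(maximalRealSubfield L)) v 2).map (toLin (↥(maximalRealSubfield L)) v (MpPsi.proj _ m₀)) =
      lagrangianY (↥(maximalRealSubfield L)) (2 + 2) v)
    (p : ↥P) (Φ : SchwartzBruhat (Fin (2 + 2) → v.adicCompletion ↥(maximalRealSubfield L))) :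
    ((MpPsi.toRep (localSchrodinger (↥(maximalRealSubfield L)) (2 + 2) (gramD (↥(maximalRealSubfield L)) 2 TV) v) m₀
          ((((localMu L χ v (Matrix.GeneralLinearGroup.det
                ((localPiEquiv L (IsCMField.complexConj L) (1 + 1) JD₁ v
                  (p : UnitaryGroup.localPi L (IsCMField.complexConj L) (1 + 1) JD₁ v)).1)))⁻¹ : ℂˣ) : ℂ) •
            MpPsi.toRep (localSchrodinger (↥(maximalRealSubfield L)) (2 + 2) (gramD (↥(maximalRealSubfield L)) 2 TV) v)
              ((localSplittingDatumCM L v μ 2 hTV hTVd rfl χ hχ).localSplitting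
                (ι (p : UnitaryGroup.localPi L (IsCMField.complexConj L) (1 + 1) JD₁ v))) Φ) :
        SchwartzBruhat (Fin (2 + 2) → v.adicCompletion ↥(maximalRealSubfield L))) :
        (Fin (2 + 2) → v.adicCompletion ↥(maximalRealSubfield L)) → ℂ) 0 =
      (((modularCharacter p : ℝ≥0) : ℝ) : ℂ) *
        ((MpPsi.toRep (localSchrodinger (↥(maximalRealSubfield L)) (2 + 2) (gramD (↥(maximalRealSubfield L)) 2 TV) v) m₀ Φ :
            SchwartzBruhat (Fin (2 + 2) → v.adicCompletion ↥(maximalRealSubfield L))) :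
            (Fin (2 + 2) → v.adicCompletion ↥(maximalRealSubfield L)) → ℂ) 0 := by
  -- the eigen-law of the doubled rank-two datum at `p′ = ι p`, `w₀ = 1`
  have hp' : IsSiegelDelta (↥(maximalRealSubfield L)) L (IsCMField.complexConj L) (complexConj_imagUnit L) (imagUnit_ne_zero L)
      (imagUnit_mul_self L) v 2 hTV rfl (1 * ι (p : UnitaryGroup.localPi L (IsCMField.complexConj L) (1 + 1) JD₁ v) * 1) := by
    rw [one_mul, mul_one]
    exact hιS _ ((hP _).1 p.2)
  have hE := apply_zero_toRep_mul_localSplitting_eq_mul L v μ 2 hTV hTVd χ hχ m₀ hm₀ 1 (mul_one 1) _ hp' Φ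
  simp only [map_one, mul_one, one_mul] at hE
  -- the twist scalar is the modulus
  have hT := twistScalar_eq_modularCharacter L χ v hχ hT₀ hT₀d hJD₁ P hP p
    (ι (p : UnitaryGroup.localPi L (IsCMField.complexConj L) (1 + 1) JD₁ v)) (hιd _)
  rw [map_smul, Submodule.coe_smul, Pi.smul_apply, smul_eq_mul, hE, ← mul_assoc, hT]

/-! ## §3 Local constancy of the orbit maps and continuity of the twisted orbit functions -/

set_option synthInstance.maxHeartbeats 400000 in -- the doubled CM datum's telescope
set_option maxHeartbeats 4000000 in
/-- **`h ↦ ω^𝔻(s^𝔻(ι h)) Φ` is locally constant on `G₁`**: the datum's smoothness (★ `LocalSplittingDatum.smooth`: `Φ` is fixed by an open subgroup `U` of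
`H₂`) and the continuity of `ι` (near `h₀` the element `ι(h₀⁻¹ h)` lies in `U`). [cite: MoeglinVignerasWaldspurger1987, Chap. 2 II.8] [cite: Kudla1994, §3 Thm. 3.1] -/
theorem isLocallyConstant_toRep_localSplitting_comp (hιc : Continuous ι)
    (Φ : SchwartzBruhat (Fin (2 + 2) → v.adicCompletion ↥(maximalRealSubfield L))) :
    IsLocallyConstant fun h : UnitaryGroup.localPi L (IsCMField.complexConj L) (1 + 1) JD₁ v =>
      MpPsi.toRep (localSchrodinger (↥(maximalRealSubfield L)) (2 + 2) (gramD (↥(maximalRealSubfield L)) 2 TV) v)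
        ((localSplittingDatumCM L v μ 2 hTV hTVd rfl χ hχ).localSplitting (ι h)) Φ := by
  obtain ⟨U, hU, hfix⟩ := (localSplittingDatumCM L v μ 2 hTV hTVd rfl χ hχ).smooth Φ
  have hfix' : ∀ k ∈ U, MpPsi.toRep (localSchrodinger (↥(maximalRealSubfield L)) (2 + 2) (gramD (↥(maximalRealSubfield L)) 2 TV) v)
      ((localSplittingDatumCM L v μ 2 hTV hTVd rfl χ hχ).localSplitting k) Φ = Φ := fun k hk => by
    change (localSplittingDatumCM L v μ 2 hTV hTVd rfl χ hχ).localOmega k Φ = Φ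
    rw [LocalSplittingDatum.localOmega_apply]
    exact hfix k hk
  refine (IsLocallyConstant.iff_eventually_eq _).2 fun h₀ => ?_
  have hopen : IsOpen {h : UnitaryGroup.localPi L (IsCMField.complexConj L) (1 + 1) JD₁ v | ι (h₀⁻¹ * h) ∈ U} :=
    hU.preimage (hιc.comp (continuous_const.mul continuous_id))
  have hmem : h₀ ∈ {h : UnitaryGroup.localPi L (IsCMField.complexConj L) (1 + 1) JD₁ v | ι (h₀⁻¹ * h) ∈ U} := by
    change ι (h₀⁻¹ * h₀) ∈ U
    rw [inv_mul_cancel, map_one]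
    exact U.one_mem
  filter_upwards [hopen.mem_nhds hmem] with h hh
  have hsplit : h = h₀ * (h₀⁻¹ * h) := by rw [mul_inv_cancel_left]
  calc MpPsi.toRep (localSchrodinger (↥(maximalRealSubfield L)) (2 + 2) (gramD (↥(maximalRealSubfield L)) 2 TV) v)
        ((localSplittingDatumCM L v μ 2 hTV hTVd rfl χ hχ).localSplitting (ι h)) Φ
      = MpPsi.toRep (localSchrodinger (↥(maximalRealSubfield L)) (2 + 2) (gramD (↥(maximalRealSubfield L)) 2 TV) v)
          ((localSplittingDatumCM L v μ 2 hTV hTVd rfl χ hχ).localSplitting (ι h₀))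
          (MpPsi.toRep (localSchrodinger (↥(maximalRealSubfield L)) (2 + 2) (gramD (↥(maximalRealSubfield L)) 2 TV) v)
            ((localSplittingDatumCM L v μ 2 hTV hTVd rfl χ hχ).localSplitting (ι (h₀⁻¹ * h))) Φ) := by
        conv_lhs => rw [hsplit]
        rw [map_mul ι h₀ (h₀⁻¹ * h), map_mul (localSplittingDatumCM L v μ 2 hTV hTVd rfl χ hχ).localSplitting,
          map_mul (MpPsi.toRep (localSchrodinger (↥(maximalRealSubfield L)) (2 + 2) (gramD (↥(maximalRealSubfield L)) 2 TV) v)),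
          Module.End.mul_apply]
    _ = MpPsi.toRep (localSchrodinger (↥(maximalRealSubfield L)) (2 + 2) (gramD (↥(maximalRealSubfield L)) 2 TV) v)
          ((localSplittingDatumCM L v μ 2 hTV hTVd rfl χ hχ).localSplitting (ι h₀)) Φ := by
        rw [hfix' _ hh]

set_option synthInstance.maxHeartbeats 400000 in -- the doubled CM datum's telescope
set_option maxHeartbeats 4000000 in
/-- **continuity of the twisted orbit functions**: for EVERY linear functional `Λ` on `𝒮(L⁺_v^{2+2})` and every `Φ`, `h ↦ Λ(s′(h) Φ)` is continuous on `G₁`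
(`h ↦ ω^𝔻(s^𝔻(ι h)) Φ` locally constant; `h ↦ μ_v(det h)⁻¹` continuous: ★ `continuous_localMu`, Mathlib `GeneralLinearGroup.continuous_det`, ★ `localPiEquiv`).
In particular `h ↦ λ′(s′(h) Φ)` is continuous. [cite: MoeglinVignerasWaldspurger1987, Chap. 2 II.8] [cite: Kudla1994, §3 Thm. 3.1] -/
theorem continuous_apply_twistedSection (hιc : Continuous ι)
    (Λ : SchwartzBruhat (Fin (2 + 2) → v.adicCompletion ↥(maximalRealSubfield L)) →ₗ[ℂ] ℂ)
    (Φ : SchwartzBruhat (Fin (2 + 2) → v.adicCompletion ↥(maximalRealSubfield L))) :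
    Continuous fun h : UnitaryGroup.localPi L (IsCMField.complexConj L) (1 + 1) JD₁ v =>
      Λ ((((localMu L χ v (Matrix.GeneralLinearGroup.det ((localPiEquiv L (IsCMField.complexConj L) (1 + 1) JD₁ v h).1)))⁻¹ : ℂˣ) : ℂ) •
        MpPsi.toRep (localSchrodinger (↥(maximalRealSubfield L)) (2 + 2) (gramD (↥(maximalRealSubfield L)) 2 TV) v)
          ((localSplittingDatumCM L v μ 2 hTV hTVd rfl χ hχ).localSplitting (ι h)) Φ) := by
  have hΛ : Continuous fun h : UnitaryGroup.localPi L (IsCMField.complexConj L) (1 + 1) JD₁ v =>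
      Λ (MpPsi.toRep (localSchrodinger (↥(maximalRealSubfield L)) (2 + 2) (gramD (↥(maximalRealSubfield L)) 2 TV) v)
        ((localSplittingDatumCM L v μ 2 hTV hTVd rfl χ hχ).localSplitting (ι h)) Φ) :=
    ((isLocallyConstant_toRep_localSplitting_comp L v μ χ hχ hTV hTVd ι hιc Φ).comp Λ).continuous
  have hdetc : Continuous fun h : UnitaryGroup.localPi L (IsCMField.complexConj L) (1 + 1) JD₁ v =>
      Matrix.GeneralLinearGroup.det ((localPiEquiv L (IsCMField.complexConj L) (1 + 1) JD₁ v h).1) :=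
    Matrix.GeneralLinearGroup.continuous_det.comp
      (continuous_subtype_val.comp (localPiEquiv L (IsCMField.complexConj L) (1 + 1) JD₁ v).continuous)
  have hc1 : Continuous fun h : UnitaryGroup.localPi L (IsCMField.complexConj L) (1 + 1) JD₁ v =>
      ((localMu L χ v (Matrix.GeneralLinearGroup.det ((localPiEquiv L (IsCMField.complexConj L) (1 + 1) JD₁ v h).1)) : ℂˣ) : ℂ) :=
    (continuous_localMu L χ v).comp hdetc
  have hc2 : Continuous fun h : UnitaryGroup.localPi L (IsCMField.complexConj L) (1 + 1) JD₁ v =>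
      (((localMu L χ v (Matrix.GeneralLinearGroup.det ((localPiEquiv L (IsCMField.complexConj L) (1 + 1) JD₁ v h).1)) : ℂˣ) : ℂ))⁻¹ :=
    hc1.inv₀ fun h => Units.ne_zero _
  refine (hc2.mul hΛ).congr fun h => ?_
  simp only [Pi.mul_apply, map_smul, smul_eq_mul, Units.val_inv_eq_inv_val]

/-! ## §4 (ED. 2) Instantiation at the Kronecker embedding ★ `kronLoc` (`ι h = h ⊗ₖ 1_V`, `T_W = 1`, `m = 2`)

ED. 2 (2026-09-02, append-only): the abstract `ι` of §2–§3 is the tree's ★ `kronLoc L⁺ L c̄ v 2 rfl rfl hJD₁` (`LocalDoubledKroneckerEmbedding`, seat LD2-p02 (g3),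
p850886 ∕ p850916): its clauses ★ `IsSiegelDelta.kronLoc`, ★ `detDelta_kronLoc` (`det_Δ²(ι p) = (det_Δ¹ p)²`), ★ `continuous_kronLoc` discharge `hιS`, `hιd`, `hιc`, so the
eigen-law and the continuity hold UNCONDITIONALLY for the soft road's twisted section `s′ h = μ_v(det h)⁻¹ • ω^𝔻(s^𝔻(h ⊗ₖ 1_V))` of the STANDARD doubled
line `G₁ = U(⟨1⟩ ⊕ ⟨−1⟩)(L⁺_v)` (`J^𝔻₁ = (gramD L⁺ 1 1) ⊗ 1`). -/

section Kron

set_option synthInstance.maxHeartbeats 400000 in -- the doubled CM datum's telescope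
set_option maxHeartbeats 4000000 in
/-- **THE EIGEN-LAW AT `ι := kronLoc` (unconditional): `λ′(s′(p) Φ) = Δ_{P_Δ}(p) · λ′(Φ)`** for `p` in the Siegel parabolic of the STANDARD doubled line
`G₁ = localPi L c̄ (1+1) ((gramD L⁺ 1 1) ⊗ 1) v`, `s′ h = μ_v(det h)⁻¹ • ω^𝔻(s^𝔻(kronLoc h))` (§2 with ★ `IsSiegelDelta.kronLoc`, ★ `detDelta_kronLoc`).
[cite: Kudla1994, §3 Thm. 3.1] [cite: HarrisKudlaSweet1996, §1 (1.15)–(1.16)] [cite: GelbartRogawski1991, §3.2] -/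
theorem apply_zero_toRep_twistedSection_kronLoc_eq_modularCharacter_mul
    (hJD₁ : JD₁ = (gramD (↥(maximalRealSubfield L)) 1 1).map (algebraMap (↥(maximalRealSubfield L)) L))
    (h1 : (1 : Matrix (Fin 1) (Fin 1) ↥(maximalRealSubfield L)).IsSymm)
    (P : Subgroup (UnitaryGroup.localPi L (IsCMField.complexConj L) (1 + 1) JD₁ v))
    (hP : ∀ h, h ∈ P ↔ IsSiegelDelta (↥(maximalRealSubfield L)) L (IsCMField.complexConj L) (complexConj_imagUnit L)
      (imagUnit_ne_zero L) (imagUnit_mul_self L) v 1 h1 hJD₁ h)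
    [LocallyCompactSpace ↥P]
    (m₀ : LocalMp (↥(maximalRealSubfield L)) (2 + 2) (gramD (↥(maximalRealSubfield L)) 2 TV) v)
    (hm₀ : (deltaLagrangian (↥(maximalRealSubfield L)) v 2).map (toLin (↥(maximalRealSubfield L)) v (MpPsi.proj _ m₀)) =
      lagrangianY (↥(maximalRealSubfield L)) (2 + 2) v)
    (p : ↥P) (Φ : SchwartzBruhat (Fin (2 + 2) → v.adicCompletion ↥(maximalRealSubfield L))) :
    ((MpPsi.toRep (localSchrodinger (↥(maximalRealSubfield L)) (2 + 2) (gramD (↥(maximalRealSubfield L)) 2 TV) v) m₀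
          ((((localMu L χ v (Matrix.GeneralLinearGroup.det
                ((localPiEquiv L (IsCMField.complexConj L) (1 + 1) JD₁ v
                  (p : UnitaryGroup.localPi L (IsCMField.complexConj L) (1 + 1) JD₁ v)).1)))⁻¹ : ℂˣ) : ℂ) •
            MpPsi.toRep (localSchrodinger (↥(maximalRealSubfield L)) (2 + 2) (gramD (↥(maximalRealSubfield L)) 2 TV) v)
              ((localSplittingDatumCM L v μ 2 hTV hTVd rfl χ hχ).localSplitting
                (kronLoc (↥(maximalRealSubfield L)) L (IsCMField.complexConj L) v 2 (T := TV) (J := TV.map (algebraMap (↥(maximalRealSubfield L)) L))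
                  rfl rfl hJD₁ (p : UnitaryGroup.localPi L (IsCMField.complexConj L) (1 + 1) JD₁ v))) Φ) :
        SchwartzBruhat (Fin (2 + 2) → v.adicCompletion ↥(maximalRealSubfield L))) :
        (Fin (2 + 2) → v.adicCompletion ↥(maximalRealSubfield L)) → ℂ) 0 =
      (((modularCharacter p : ℝ≥0) : ℝ) : ℂ) *
        ((MpPsi.toRep (localSchrodinger (↥(maximalRealSubfield L)) (2 + 2) (gramD (↥(maximalRealSubfield L)) 2 TV) v) m₀ Φ :
            SchwartzBruhat (Fin (2 + 2) → v.adicCompletion ↥(maximalRealSubfield L))) :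
            (Fin (2 + 2) → v.adicCompletion ↥(maximalRealSubfield L)) → ℂ) 0 :=
  apply_zero_toRep_twistedSection_eq_modularCharacter_mul L v μ χ hχ hTV hTVd
    (kronLoc (↥(maximalRealSubfield L)) L (IsCMField.complexConj L) v 2 (T := TV) (J := TV.map (algebraMap (↥(maximalRealSubfield L)) L)) rfl rfl hJD₁)
    h1 (by rw [Matrix.det_one]; exact isUnit_one) hJD₁ P hP (fun _ hp => hp.kronLoc)
    (fun p w => detDelta_kronLoc (↥(maximalRealSubfield L)) L (IsCMField.complexConj L) v 2 (T := TV) rfl rfl hJD₁ w p) m₀ hm₀ p Φ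

set_option synthInstance.maxHeartbeats 400000 in -- the doubled CM datum's telescope
set_option maxHeartbeats 4000000 in
/-- **continuity at `ι := kronLoc` (unconditional)**: for every linear functional `Λ` and every `Φ`, `h ↦ Λ(s′(h) Φ)` is continuous on the standard doubled
line, `s′ h = μ_v(det h)⁻¹ • ω^𝔻(s^𝔻(kronLoc h))` (§3 with ★ `continuous_kronLoc`). [cite: MoeglinVignerasWaldspurger1987, Chap. 2 II.8] [cite: Kudla1994, §3 Thm. 3.1] -/
theorem continuous_apply_twistedSection_kronLoc
    (hJD₁ : JD₁ = (gramD (↥(maximalRealSubfield L)) 1 1).map (algebraMap (↥(maximalRealSubfield L)) L))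
    (Λ : SchwartzBruhat (Fin (2 + 2) → v.adicCompletion ↥(maximalRealSubfield L)) →ₗ[ℂ] ℂ)
    (Φ : SchwartzBruhat (Fin (2 + 2) → v.adicCompletion ↥(maximalRealSubfield L))) :
    Continuous fun h : UnitaryGroup.localPi L (IsCMField.complexConj L) (1 + 1) JD₁ v =>
      Λ ((((localMu L χ v (Matrix.GeneralLinearGroup.det ((localPiEquiv L (IsCMField.complexConj L) (1 + 1) JD₁ v h).1)))⁻¹ : ℂˣ) : ℂ) •
        MpPsi.toRep (localSchrodinger (↥(maximalRealSubfield L)) (2 + 2) (gramD (↥(maximalRealSubfield L)) 2 TV) v)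
          ((localSplittingDatumCM L v μ 2 hTV hTVd rfl χ hχ).localSplitting
            (kronLoc (↥(maximalRealSubfield L)) L (IsCMField.complexConj L) v 2 (T := TV) (J := TV.map (algebraMap (↥(maximalRealSubfield L)) L))
              rfl rfl hJD₁ h)) Φ) :=
  continuous_apply_twistedSection L v μ χ hχ hTV hTVd
    (kronLoc (↥(maximalRealSubfield L)) L (IsCMField.complexConj L) v 2 (T := TV) (J := TV.map (algebraMap (↥(maximalRealSubfield L)) L)) rfl rfl hJD₁)
    (continuous_kronLoc (↥(maximalRealSubfield L)) L (IsCMField.complexConj L) v 2 (T := TV) rfl rfl hJD₁) Λ Φ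

end Kron

end Literature.NumberTheory.GelbartRogawski1991.UnitaryDualPair.LocalSplitting

end
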